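import Mathlib
import Literature.AlgebraicGeometry.Resolution.LocalBlowup
import Literature.AlgebraicGeometry.Resolution.QuadraticTransformsRegular
import Literature.AlgebraicGeometry.Resolution.RegularCentreRsopPart
import Literature.AlgebraicGeometry.Resolution.QuasiRegularSequences
import Literature.AlgebraicGeometry.Resolution.BlowupChartRegular
import Literature.AlgebraicGeometry.Resolution.RegularLocalRingsProofs
import Literature.AlgebraicGeometry.Resolution.AdicCompletionRegular
import Literature.AlgebraicGeometry.Resolution.NodalBlowupChartAlgebra
import HarnessLib

/-!
# Crux `Steer` (stmt-ResolutionOfSingularities-16345), line `switching_dichotomy` — M: the members of a σ_top-steered run are REGULAR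

Helper for piece **M `SteeredMembersRegular`** of the σ_top-steered composition at `p = 2`
(res-L0-w41-plan-1, `L/w41/R2TwoSigma-r19.snippet.lean` ab3ec70bee111df3 §σ2.2; chain W4.1),
and through it for **B₂ `EmptyStallTwo`** (= M + `EmptyStallTwo.false_of_isSingPrime_two`,
p499359). OURS — statements about the route's own objects (local blowings up along a valuation,
Novacoski–Spivakovsky Def. 2.11); nothing here is a statement of the manuscript under review.

**The fact** (`isRegularLocalRing_of_isLocalBlowupAlong`). Let `R ⊆ K` be a regular local ring
contained in the valuation ring `O`, `P` an ideal of `R` with `R ⧸ P` a regular local ring (a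
PERMISSIBLE centre: `P = 𝔪` for a point step, or a regular positive-dimensional centre), and `R'`
the local blowing up of `R` along `P` with respect to `O` (`IsLocalBlowupAlong O R P R'`). Then `R'`
is a regular local ring.

Proof: `P` is generated by a part `z` of a regular system of parameters (Matsumura 14.2,
`exists_isRsopPart_span_range_eq`); `z` is quasi-regular (a sub-family of a regular system of
parameters: Rees, `IsRsopPart.isQuasiRegular`), and `R ⧸ (z)` is regular, so the chart `R[P/z_i]` of the
blowing up is a regular ring (`isRegularRing_blowupChart` realised in `K` by
`isRegularRing_closure_of_isRegularRing_blowupChart`) for the member `z_i` of maximal `O`-value;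
the local blowing up does not depend on the generating set and generator of maximal value used to
write it (`locAtCentre_closure_div_eq`: for `a, b ∈ P` of the same maximal value, `a/b` is a unit
at the centre), so `R' = (R[P/z_i])_{𝔪_O ∩ R[P/z_i]}` is regular
(`isRegularLocalRing_locAtCentre_of_isRegularRing`). The case `P = 𝔪` is the tree's
`IsQuadraticTransformAlong.isRegularLocalRing_of_isRegularLocalRing`, reproved here uniformly.

* `isRegularLocalRing_steps` — along finitely many such steps (centres `P i` with `R i ⧸ P i`
  regular OR `P i = 𝔪`), every member is regular: the run form with the minimal binders.
-/

-- The namespace mirrors the chain's helper layout (`…Theorems.SwitchingDichotomy.<Piece>`) on purpose.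
set_option linter.dupNamespace false

noncomputable section

namespace Summit.ResolutionOfSingularities.ResolutionOfSingularities.Theorems.SwitchingDichotomy.SteeredMembersRegular

open IsLocalRing Literature.AlgebraicGeometry.Resolution

universe u

variable {K : Type u} [Field K]

/-! ## The chart `R[P/x] ⊆ K` of the blowing up along `P` -/

/-- If `u ⊆ R` generates the ideal `P` then `R[u/x] = R[P/x]` inside `K`: for `y = Σ rᵢ uᵢ`,
`y/x = Σ rᵢ (uᵢ/x)`. (The analogue of `blowupRing_eq_closure_of_span_eq` for an arbitrary
ideal.) [folklore] -/
theorem closure_div_eq_of_span_eq (R : Subring K) (x : K) {P : Ideal R} (u : Set R)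
    (hu : Ideal.span u = P) :
    Subring.closure ((R : Set K) ∪ (fun y : R => (y : K) / x) '' u) =
      Subring.closure ((R : Set K) ∪ (fun y : R => (y : K) / x) '' (P : Set R)) := by
  apply le_antisymm
  · refine Subring.closure_mono ?_
    rintro z (hz | ⟨y, hy, rfl⟩)
    · exact Or.inl hz
    · exact Or.inr ⟨y, hu ▸ Ideal.subset_span hy, rfl⟩
  · refine Subring.closure_le.mpr ?_
    rintro z (hz | ⟨y, hy, rfl⟩)
    · exact Subring.subset_closure (Or.inl hz)
    · change ((y : R) : K) / x ∈ Subring.closure ((R : Set K) ∪ (fun y : R => (y : K) / x) '' u)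
      rw [SetLike.mem_coe, ← hu] at hy
      induction hy using Submodule.span_induction with
      | mem y hy => exact Subring.subset_closure (Or.inr ⟨y, hy, rfl⟩)
      | zero => simp
      | add y z _ _ hy hz => rw [Subring.coe_add, add_div]; exact Subring.add_mem _ hy hz
      | smul a y _ hy =>
        rw [smul_eq_mul, Subring.coe_mul, mul_div_assoc]
        exact Subring.mul_mem _ (Subring.subset_closure (Or.inl a.2)) hy

/-- `R ⊆ R[P/x]`. [folklore] -/
theorem le_closure_div (R : Subring K) (x : K) (P : Ideal R) :
    R ≤ Subring.closure ((R : Set K) ∪ (fun y : R => (y : K) / x) '' (P : Set R)) :=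
  fun _ hz => Subring.subset_closure (Or.inl hz)

/-- `y/x ∈ R[P/x]` for `y ∈ P`. [folklore] -/
theorem div_mem_closure_div {R : Subring K} (x : K) {P : Ideal R} {y : R} (hy : y ∈ P) :
    (y : K) / x ∈ Subring.closure ((R : Set K) ∪ (fun y : R => (y : K) / x) '' (P : Set R)) :=
  Subring.subset_closure (Or.inr ⟨y, hy, rfl⟩)

/-- In a valuation-theoretic local blowing up, a generator of MAXIMAL `O`-valuation (= minimal
value) among a generating set of `P` has maximal `O`-valuation on all of `P` (ultrametric
inequality; `R ⊆ O`). [folklore] -/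
theorem valuation_le_of_mem_span {O : ValuationSubring K} {R : Subring K} (hRO : R ≤ O.toSubring)
    {u : Set R} {u₀ : K} (hval : ∀ x ∈ u, O.valuation (x : K) ≤ O.valuation u₀)
    {y : R} (hy : y ∈ Ideal.span u) : O.valuation (y : K) ≤ O.valuation u₀ := by
  induction hy using Submodule.span_induction with
  | mem y hy => exact hval y hy
  | zero => simp
  | add y z _ _ hy hz =>
    rw [Subring.coe_add]
    exact (Valuation.map_add _ _ _).trans (max_le hy hz)
  | smul a y _ hy =>
    rw [smul_eq_mul, Subring.coe_mul, map_mul]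
    calc O.valuation (a : K) * O.valuation (y : K) ≤ 1 * O.valuation u₀ :=
          mul_le_mul' ((O.valuation_le_one_iff _).mpr (hRO a.2)) hy
      _ = O.valuation u₀ := one_mul _

/-- **The local blowing up along `P` does not depend on the generator of maximal value**: for
`a, b ∈ P` nonzero with the same `O`-valuation, `(R[P/a])_{𝔪_O ∩ R[P/a]} = (R[P/b])_{𝔪_O ∩ R[P/b]}`
(`a/b` and `b/a` are units at the centre). The analogue of `IsQuadraticTransformAlong.unique`.
[cite: NovacoskiSpivakovsky2014, after Lemma 2.10] -/
theorem locAtCentre_closure_div_eq {O : ValuationSubring K} {R : Subring K} {P : Ideal R}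
    {a b : R} (ha : a ∈ P) (hb : b ∈ P) (ha0 : (a : K) ≠ 0) (hb0 : (b : K) ≠ 0)
    (hab : O.valuation (a : K) = O.valuation (b : K)) :
    locAtCentre (Subring.closure ((R : Set K) ∪ (fun y : R => (y : K) / a) '' (P : Set R))) O =
      locAtCentre (Subring.closure ((R : Set K) ∪ (fun y : R => (y : K) / b) '' (P : Set R))) O := by
  -- the key inclusion, symmetric in the two generators
  have key : ∀ (a b : R), (a : K) ≠ 0 → (b : K) ≠ 0 → a ∈ P →
      O.valuation (a : K) = O.valuation (b : K) →
      Subring.closure ((R : Set K) ∪ (fun y : R => (y : K) / a) '' (P : Set R)) ≤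
        locAtCentre (Subring.closure ((R : Set K) ∪ (fun y : R => (y : K) / b) '' (P : Set R))) O := by
    intro a b ha hb haP hab
    refine Subring.closure_le.mpr ?_
    rintro z (hz | ⟨y, hy, rfl⟩)
    · exact le_locAtCentre _ O (le_closure_div R _ P hz)
    · -- `y/a = (y/b) / (a/b)` with `a/b ∈ R[P/b]` of value `1`
      have hab1 : O.valuation ((a : K) / b) = 1 := by
        rw [map_div₀, hab, div_self ((map_ne_zero _).mpr hb)]
      refine ⟨(y : K) / b, div_mem_closure_div _ hy, (a : K) / b, div_mem_closure_div _ haP,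
        hab1, ?_⟩
      change ((y : R) : K) / a = (y : K) / b / ((a : K) / b)
      field_simp
  apply le_antisymm
  · calc locAtCentre (Subring.closure ((R : Set K) ∪ (fun y : R => (y : K) / a) '' (P : Set R))) O
        ≤ locAtCentre (locAtCentre
            (Subring.closure ((R : Set K) ∪ (fun y : R => (y : K) / b) '' (P : Set R))) O) O :=
          locAtCentre_mono O (key a b ha0 hb0 ha hab)
      _ = _ := locAtCentre_locAtCentre _ O
  · calc locAtCentre (Subring.closure ((R : Set K) ∪ (fun y : R => (y : K) / b) '' (P : Set R))) O
        ≤ locAtCentre (locAtCentre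
            (Subring.closure ((R : Set K) ∪ (fun y : R => (y : K) / a) '' (P : Set R))) O) O :=
          locAtCentre_mono O (key b a hb0 ha0 hb hab.symm)
      _ = _ := locAtCentre_locAtCentre _ O

/-! ## The local blowing up along a permissible centre of a regular local ring is regular -/

/-- **Blowing up a regular local ring along a regular centre, locally along a valuation, gives a
regular local ring.** If `R ⊆ K` is a regular local ring, `P` an ideal with `R ⧸ P` a regular
local ring, and `R'` is the local blowing up of `R` along `P` with respect to the valuation ring
`O ⊇ R` (`IsLocalBlowupAlong O R P R'`, Novacoski–Spivakovsky Def. 2.11), then `R'` is a regular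
local ring. [cite: Liu2002, Thm. 8.1.19 (a)] [cite: Matsumura1987, Thm. 14.2]
[cite: NovacoskiSpivakovsky2014, Def. 2.11] -/
theorem isRegularLocalRing_of_isLocalBlowupAlong {O : ValuationSubring K} {R R' : Subring K}
    {P : Ideal R} (h : IsLocalBlowupAlong O R P R') (hR : IsRegularLocalRing R)
    (hP : IsRegularLocalRing (R ⧸ P)) : IsRegularLocalRing R' := by
  classical
  obtain ⟨hRO, u, u₀, hu, hu₀, h0, hval, rfl⟩ := h
  have h0' : ((u₀ : R) : K) ≠ 0 := fun e => h0 (Subtype.ext e)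
  have hu₀P : u₀ ∈ P := hu ▸ Ideal.subset_span (Finset.mem_coe.mpr hu₀)
  -- `u₀` has maximal valuation on all of `P`
  have hvalP : ∀ y ∈ P, O.valuation (y : K) ≤ O.valuation (u₀ : K) := fun y hy =>
    valuation_le_of_mem_span hRO (u := (↑u : Set R)) hval (hu.symm ▸ hy)
  -- `P` is proper, hence inside `𝔪`
  have hPne : P ≠ ⊤ := by
    intro hT
    have : Subsingleton (R ⧸ P) := Ideal.Quotient.subsingleton_iff.mpr hT
    exact false_of_nontrivial_of_subsingleton (R ⧸ P)
  have hPm : P ≤ maximalIdeal R := IsLocalRing.le_maximalIdeal hPne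
  -- `P` is generated by a part `z` of a regular system of parameters
  haveI := hR
  haveI := hP
  obtain ⟨r, z, hz, hzP⟩ := exists_isRsopPart_span_range_eq hPm
  -- some `z j` is nonzero (as `u₀ ∈ P` is)
  have hne : ∃ j ∈ (Finset.univ : Finset (Fin r)), ((z j : R) : K) ≠ 0 := by
    by_contra hcon
    have hall : ∀ j, z j = 0 := fun j => by
      by_contra hj
      exact hcon ⟨j, Finset.mem_univ j, fun h0 => hj (Subtype.ext h0)⟩
    have hbot : Ideal.span (Set.range z) = ⊥ := by
      rw [Ideal.span_eq_bot]
      rintro _ ⟨j, rfl⟩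
      exact hall j
    rw [hzP] at hbot
    rw [hbot] at hu₀P
    exact h0 ((Submodule.mem_bot _).mp hu₀P)
  obtain ⟨i, -, hi0, hmax⟩ := exists_max_valuation O Finset.univ (fun j => ((z j : R) : K)) hne
  have hziP : z i ∈ P := hzP ▸ Ideal.subset_span ⟨i, rfl⟩
  -- `z i` and `u₀` have the same (maximal) valuation on `P`
  have hv : O.valuation ((z i : R) : K) = O.valuation ((u₀ : R) : K) := by
    refine le_antisymm (hvalP _ hziP) ?_
    exact valuation_le_of_mem_span hRO (u := Set.range z)
      (by rintro _ ⟨j, rfl⟩; exact hmax j (Finset.mem_univ j)) (hzP.symm ▸ hu₀P)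
  -- rewrite the local blowing up in the `z i`-chart
  rw [closure_div_eq_of_span_eq R ((u₀ : R) : K) (↑u : Set R) hu,
    ← locAtCentre_closure_div_eq hziP hu₀P hi0 h0' hv,
    ← closure_div_eq_of_span_eq R ((z i : R) : K) (Set.range z) hzP]
  -- the `z i`-chart `R[P/z_i]` is a regular ring
  haveI : IsRegularRing R := isRegularRing_of_isRegularLocalRing R
  haveI : IsRegularRing (R ⧸ Ideal.span (Set.range z)) := by
    rw [hzP]
    exact isRegularRing_of_isRegularLocalRing _
  have hB := isRegularRing_blowupChart z i hz.isQuasiRegular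
  have hreg := isRegularRing_closure_of_isRegularRing_blowupChart R.subtype z i
    Subtype.val_injective hi0 hB
  have hset : ((R.subtype.range : Set K) ∪ Set.range fun j => R.subtype (z j) / R.subtype (z i)) =
      (R : Set K) ∪ (fun y : R => (y : K) / ((z i : R) : K)) '' Set.range z := by
    rw [Subring.range_subtype, ← Set.range_comp]
    rfl
  rw [hset] at hreg
  haveI := hreg
  -- the chart lies in `O` (`z j / z i` has valuation `≤ 1`), so its local ring at the centre is regular
  refine isRegularLocalRing_locAtCentre_of_isRegularRing (Subring.closure_le.mpr ?_)
  rintro w (hw | ⟨y, ⟨j, rfl⟩, rfl⟩)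
  · exact hRO hw
  · change ((z j : R) : K) / ((z i : R) : K) ∈ O.toSubring
    rw [ValuationSubring.mem_toSubring, ← O.valuation_le_one_iff, map_div₀,
      div_le_one₀ (pos_iff_ne_zero.mpr ((map_ne_zero _).mpr hi0))]
    exact hmax j (Finset.mem_univ j)

/-- **Run form with the minimal binders.** Along finitely many local blowings up
`R (i+1)` of `R i` along centres `P i` with respect to `O` (`i < N`), each centre being the
closed point or having a regular quotient `R i ⧸ P i`, every member `R i`, `i ≤ N`, is a regular
local ring if `R 0` is. [cite: NovacoskiSpivakovsky2014, Def. 2.11] [cite: Liu2002, Thm. 8.1.19 (a)] -/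
theorem isRegularLocalRing_steps {O : ValuationSubring K} (R : ℕ → Subring K)
    (P : (i : ℕ) → Ideal (R i)) (N : ℕ) (h0 : IsRegularLocalRing (R 0))
    (hstep : ∀ i < N, ∃ _ : IsLocalRing (R i),
      (IsRegularLocalRing (R i ⧸ P i) ∨ P i = maximalIdeal (R i)) ∧
        IsLocalBlowupAlong O (R i) (P i) (R (i + 1))) :
    ∀ i ≤ N, IsRegularLocalRing (R i) := by
  intro i hi
  induction i with
  | zero => exact h0
  | succ i ih =>
    have hreg : IsRegularLocalRing (R i) := ih (Nat.le_of_succ_le hi)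
    obtain ⟨_, hcases, hbl⟩ := hstep i (Nat.lt_of_succ_le hi)
    rcases hcases with hq | hm
    · exact isRegularLocalRing_of_isLocalBlowupAlong hbl hreg hq
    · have hqt : IsQuadraticTransformAlong O (R i) (R (i + 1)) := ⟨‹_›, hm ▸ hbl⟩
      exact hqt.isRegularLocalRing_of_isRegularLocalRing hreg

end Summit.ResolutionOfSingularities.ResolutionOfSingularities.Theorems.SwitchingDichotomy.SteeredMembersRegular

end
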